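import Mathlib
import HarnessLib
import Literature.MathematicalPhysics.QuantumLattice.SectorisedEffectiveActionBoundPlateau
import Literature.MathematicalPhysics.QuantumLattice.GrassmannEffectiveActionScales
import Summits.HubbardSuperconductivity.HubbardSuperconductivity.Theorems.KLProgrammeKLRegimeSectorRadialAlignment
import Summits.HubbardSuperconductivity.HubbardSuperconductivity.Theorems.KLProgrammeKLRegimeWickSecondOrder

/-!
# Route `KLProgramme` — ENGINE child stmt-HubbardSuperconductivity-20236 `KLRegimeEngineV16`, stub (b) `stub_engine_step_norms` at the
# inductive scales: THE NORMS-STEP DOOR — the sectorised single-slice step `𝒱_{n+1} = effAction g_{n+1} 𝒱_n` (n ≥ 1) bounded in the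
# thin families of indices `n` (private invariant) and `n+1` (the public (E1-v4) quantity) from the sizes of `𝒱_n` in the thin family of
# index `n−1`, MODULO named slice constants

Cell gate-hubbard-kl, seat hubbard-kl-r2d-p2 (g4), plan g15 START-HERE (KL STATUS 2026-08-27T08:41:42Z) keyed to stub (b); frame = k3c2-p3's
SECTOR-RADIAL-ALIGNMENT (evidence #13 on 20236; kernel-checked in `…KLRegimeSectorRadialAlignment`): the thin family `klAnisoFamily … k` is a
complete partition of unity exactly on `{t ≤ Λ_{k+1}}` (`t² = ω² + e_K²`), the slice `klSliceCov (k+2) = C^K_{(Λ_{k+2}, Λ_{k+1}]}` and the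
thin families of index `≥ k+1` live on `{t < Λ_{k+1}}`; so the step `𝒱_{k+1} ↦ 𝒱_{k+2}` (i.e. `n ↦ n+1`, `n = k+1 ≥ 1`) runs with INPUT family
`klAnisoFamily k` / fat partner `bgmFatMultiplier k` and OUTPUT family `klAnisoFamily j`, `j ≥ k+1`, through the plateau form of the single-scale
step (`Literature.…SectorisedEffectiveActionBoundPlateau.hubbardSectorKernelNorm_effAction_le_of_sectorNorm_of_plateau`: the support hypothesis
bears on the slice and the output family, not on `𝒱_{k+1}`, whose kernels live at all momenta).

* §1 plateau facts of the step: `klAnisoFamily_eq_zero_of_sum_eq_zero`, `klSliceCov_succ_succ_apply_eq_zero_of_le_left/right` (the slice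
  `klSliceCov (k+2)` has no entry with a leg at `t ≥ Λ_{k+1}`), `klScale_le_klScale` (antitone scales);
* §2 **`klNormsStep_of_sliceConsts`** — for every `k`, from `klStepPartitionFn … (k+1) ≠ 0`, input sizes
  `ε·‖𝒱_{k+1}‖_{klAnisoFamily k, univ, 2m′} ≤ Nin m′` (the private invariant P(k+1) of the alignment memo §3), the slice constants of
  `S(F̃_k)ᵀ·klSliceCov (k+2)·S(F̃_k)` (Gram `q/fv/gv/κ`, `hrow/hcol ≤ α`), the overlap constants `(cr, cc)` of `(klAnisoFamily j, F̃_k)`, a radius `ρ`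
  and `θ = eα·normV κ ρ Nin/κ² < 1`:  `klStepPartitionFn … (k+2) ≠ 0` AND, in every degree `m+1` and every constraint set `A`,
  `hubbardSectorKernelNorm (klAnisoFamily j) A 𝒱_{k+2} ≤ cr·cc^m·ε^m·ρ^{-(m+1)}·e·normV κ ρ Nin/(1−θ)`;
* §3 the two readings: `j = k+1` is P(k+2) (`klNormsStep_private`), `j = k+2` with `A = bgmSectorSet` is the left side of (E1-v4)
  `klAnisoLegKernelNorm … (k+2) (m+1)` (`klAnisoLegKernelNorm_le_of_sliceConsts`).

RESIDUAL (by hypothesis name · producer · lane): `q fv gv κ hC hf hg hGram` = Gram form of the sectorised slice · `isGramBoundedR_sliceCT_bgmFat`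
/ …SectorSliceGram(Fat), regime-keyed pairing-robust twin announced · k3c2-p3; `α hrow hcol` = row/column sums · `rowSum_sliceCT_bgmFat_le` at the
SHIFTED slice (fat index k, slice index k+2) · k3c2-p3 (named missing signature of their memo §3); `cr cc hrow' hcol'` = thin(j)×fat(k) overlap ·
`overlap_sums_klAniso_bgmFat_*` (…SectorMultiplierOverlap(Regime)) · p4; `Nin`, `hθ`, `ρ` and the FIT of the right side into
`CE^p ε_{n+1}^{p−1} 2^{(3p−5)(n+1)}` = the E1 power counting (sector counting DR2000 L11/L12) · k3c2-p3 / p5; the first step `𝒱_0 ↦ 𝒱_1` is NOT an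
instance (no thin family has plateau `⊇ {t < Λ_0}`; scale-0/1 lanes).  Everything here is proved; no definitions; nothing about the model is asserted
beyond these implications.
-/

noncomputable section

namespace Summit.HubbardSuperconductivity.HubbardSuperconductivity.Theorems.EngineV8

set_option linter.dupNamespace false -- summit = problem name (single-conjunct summit), D-0017

open Real Finset Literature.MathematicalPhysics.QuantumLattice Literature.Probability.LatticeModels GrassmannAlgebra
open Summit.HubbardSuperconductivity.HubbardSuperconductivity.Theorems.KLProgrammeLegKernels
open Summit.HubbardSuperconductivity.HubbardSuperconductivity.Theorems.KLRegimeSplit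
open Summit.HubbardSuperconductivity.HubbardSuperconductivity.Theorems.KLRegimeWick
open Summit.HubbardSuperconductivity.HubbardSuperconductivity.Theorems.TwoPointAssembly
open scoped InnerProductSpace

variable {L M : ℕ} [NeZero L]

/-! ## §1 Plateau facts of the step `k+1 ↦ k+2` -/

/-- The scales are antitone: `a ≤ b ⇒ Λ_b ≤ Λ_a` (`0 ≤ e₀`). -/
theorem klScale_le_klScale {e₀ : ℝ} (he : 0 ≤ e₀) {a b : ℕ} (hab : a ≤ b) : klScale e₀ b ≤ klScale e₀ a := by
  unfold klScale
  exact mul_le_mul_of_nonneg_left (inv_anti₀ (by positivity) (pow_le_pow_right₀ (by norm_num) hab)) he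

omit [NeZero L] in
/-- Where the thin family sums to `0`, every member vanishes (the multipliers are the scale cutoff times a nonnegative angular
partition: `Σ_ω F_ω = C_h⁻¹`). -/
theorem klAnisoFamily_eq_zero_of_sum_eq_zero (β μ : ℝ) (K : TrigPolyC4v) (e₀ : ℝ) (n : ℕ) (k : FreqMomentum L M)
    (h : ∑ ω, klAnisoFamily L M β μ K e₀ n ω k = 0) (ω : Fin (sectorCount n)) : klAnisoFamily L M β μ K e₀ n ω k = 0 := by
  rw [klAnisoFamily, sum_bgmMultiplier, Complex.ofReal_eq_zero] at h
  rw [klAnisoFamily, bgmMultiplier, h, zero_mul, Complex.ofReal_zero]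

omit [NeZero L] in
/-- Above a scale the cutoff weight is `1`: `Λ² ≤ ω_k² + e_K(k⃗)²`, `0 < Λ` ⇒ `w_Λ(k) = 1`. -/
theorem hubbardCutoffWeightCT_eq_one_of_sq_le (β μ : ℝ) (K : TrigPolyC4v) {Λ : ℝ} (hΛ : 0 < Λ) (k : FreqMomentum L M)
    (hk : Λ ^ 2 ≤ matsubaraFreq β M k.1 ^ 2 + nambuXiCT L μ K k.2 ^ 2) : hubbardCutoffWeightCT L M β μ K Λ k = 1 := by
  unfold hubbardCutoffWeightCT
  exact salmhoferCutoff_of_ge ((one_le_div (by positivity)).2 hk)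

omit [NeZero L] in
/-- **The slice `klSliceCov (k+2) = C^K_{(Λ_{k+2}, Λ_{k+1}]}` has no entry whose LEFT leg sits at `t ≥ Λ_{k+1}`.** -/
theorem klSliceCov_succ_succ_apply_eq_zero_of_le_left (β μ : ℝ) (K : TrigPolyC4v) (k : ℕ) (X Y : HubbardFieldIdx L M)
    (hX : klScale klE0 (k + 1) ^ 2 ≤ matsubaraFreq β M X.1.1.1 ^ 2 + nambuXiCT L μ K X.1.1.2 ^ 2) :
    klSliceCov L M β μ K (k + 2) X Y = 0 := by
  have hΛ1 : 0 < klScale klE0 (k + 1) := klth_klScale_pos _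
  have hΛ2 : 0 < klScale klE0 (k + 2) := klth_klScale_pos _
  have h21 : klScale klE0 (k + 2) ^ 2 ≤ klScale klE0 (k + 1) ^ 2 :=
    pow_le_pow_left₀ hΛ2.le (klScale_le_klScale (by norm_num [klE0]) (Nat.le_succ _)) 2
  have hw1 : hubbardCutoffWeightCT L M β μ K (klScale klE0 (k + 1)) (momentumOf L M X) = 1 :=
    hubbardCutoffWeightCT_eq_one_of_sq_le β μ K hΛ1 _ hX
  have hw2 : hubbardCutoffWeightCT L M β μ K (klScale klE0 (k + 2)) (momentumOf L M X) = 1 :=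
    hubbardCutoffWeightCT_eq_one_of_sq_le β μ K hΛ2 _ (h21.trans hX)
  rw [klSliceCov, show k + 2 - 1 = k + 1 by omega, hubbardCovSliceCT, Matrix.sub_apply]
  by_cases hXY : X.1 = Y.1
  · have hmY : momentumOf L M Y = momentumOf L M X := by simp only [momentumOf]; rw [hXY]
    simp only [hubbardCovAboveCT, Matrix.of_apply, hmY, hw1, hw2]
    norm_num
  · simp only [hubbardCovAboveCT, Matrix.of_apply]
    rw [hubbardCovarianceCT_eq_zero_of_fst_ne β μ K hXY, mul_zero, mul_zero, sub_self]

omit [NeZero L] in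
/-- **… and none whose RIGHT leg sits at `t ≥ Λ_{k+1}`.** -/
theorem klSliceCov_succ_succ_apply_eq_zero_of_le_right (β μ : ℝ) (K : TrigPolyC4v) (k : ℕ) (X Y : HubbardFieldIdx L M)
    (hY : klScale klE0 (k + 1) ^ 2 ≤ matsubaraFreq β M Y.1.1.1 ^ 2 + nambuXiCT L μ K Y.1.1.2 ^ 2) :
    klSliceCov L M β μ K (k + 2) X Y = 0 := by
  have hΛ1 : 0 < klScale klE0 (k + 1) := klth_klScale_pos _
  have hΛ2 : 0 < klScale klE0 (k + 2) := klth_klScale_pos _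
  have h21 : klScale klE0 (k + 2) ^ 2 ≤ klScale klE0 (k + 1) ^ 2 :=
    pow_le_pow_left₀ hΛ2.le (klScale_le_klScale (by norm_num [klE0]) (Nat.le_succ _)) 2
  have hw1 : hubbardCutoffWeightCT L M β μ K (klScale klE0 (k + 1)) (momentumOf L M Y) = 1 :=
    hubbardCutoffWeightCT_eq_one_of_sq_le β μ K hΛ1 _ hY
  have hw2 : hubbardCutoffWeightCT L M β μ K (klScale klE0 (k + 2)) (momentumOf L M Y) = 1 :=
    hubbardCutoffWeightCT_eq_one_of_sq_le β μ K hΛ2 _ (h21.trans hY)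
  rw [klSliceCov, show k + 2 - 1 = k + 1 by omega, hubbardCovSliceCT, Matrix.sub_apply]
  by_cases hXY : X.1 = Y.1
  · have hmX : momentumOf L M X = momentumOf L M Y := by simp only [momentumOf]; rw [hXY]
    simp only [hubbardCovAboveCT, Matrix.of_apply, hmX, hw1, hw2]
    norm_num
  · simp only [hubbardCovAboveCT, Matrix.of_apply]
    rw [hubbardCovarianceCT_eq_zero_of_fst_ne β μ K hXY, mul_zero, mul_zero, sub_self]

omit [NeZero L] in
/-- **The slice of step `k+1 ↦ k+2` lives in the plateau of the thin family of index `k`**: an entry of `klSliceCov (k+2)` is nonzero only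
if both legs have `Σ_ω klAnisoFamily … k ω = 1`. -/
theorem sum_klAnisoFamily_eq_one_of_klSliceCov_ne_zero (β μ : ℝ) (K : TrigPolyC4v) (k : ℕ) (X Y : HubbardFieldIdx L M)
    (h : klSliceCov L M β μ K (k + 2) X Y ≠ 0) :
    ∑ ω, klAnisoFamily L M β μ K klE0 k ω X.1.1 = 1 ∧ ∑ ω, klAnisoFamily L M β μ K klE0 k ω Y.1.1 = 1 := by
  have hΛ : 0 < klScale klE0 (k + 1) := klth_klScale_pos _
  have he : (0 : ℝ) < klE0 := by norm_num [klE0]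
  constructor
  · have hX : matsubaraFreq β M X.1.1.1 ^ 2 + nambuXiCT L μ K X.1.1.2 ^ 2 < klScale klE0 (k + 1) ^ 2 :=
      lt_of_not_ge fun hge => h (klSliceCov_succ_succ_apply_eq_zero_of_le_left β μ K k X Y hge)
    exact sum_klAnisoFamily_eq_one_of_le β μ K he k X.1.1 ((Real.sqrt_lt' hΛ).2 hX).le
  · have hY : matsubaraFreq β M Y.1.1.1 ^ 2 + nambuXiCT L μ K Y.1.1.2 ^ 2 < klScale klE0 (k + 1) ^ 2 :=
      lt_of_not_ge fun hge => h (klSliceCov_succ_succ_apply_eq_zero_of_le_right β μ K k X Y hge)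
    exact sum_klAnisoFamily_eq_one_of_le β μ K he k Y.1.1 ((Real.sqrt_lt' hΛ).2 hY).le

omit [NeZero L] in
/-- **Every thin family of index `j ≥ k+1` lives in the plateau of the thin family of index `k`**: `klAnisoFamily … j ω′ p ≠ 0 ⇒
Σ_ω klAnisoFamily … k ω p = 1`. -/
theorem sum_klAnisoFamily_eq_one_of_klAnisoFamily_ne_zero (β μ : ℝ) (K : TrigPolyC4v) {k j : ℕ} (hj : k + 1 ≤ j)
    (ω' : Fin (sectorCount j)) (p : FreqMomentum L M) (h : klAnisoFamily L M β μ K klE0 j ω' p ≠ 0) :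
    ∑ ω, klAnisoFamily L M β μ K klE0 k ω p = 1 := by
  have he : (0 : ℝ) < klE0 := by norm_num [klE0]
  have hlt : Real.sqrt (matsubaraFreq β M p.1 ^ 2 + nambuXiCT L μ K p.2 ^ 2) < klScale klE0 j :=
    lt_of_not_ge fun hge => h (klAnisoFamily_eq_zero_of_le β μ K he j ω' p hge)
  exact sum_klAnisoFamily_eq_one_of_le β μ K he k p (hlt.le.trans (klScale_le_klScale he.le hj))

/-! ## §2 The norms-step door -/

section Door

variable [NeZero M]

/-- **`klNormsStep_of_sliceConsts` — the n ≥ 1 NORMS-STEP DOOR of `stub_engine_step_norms`** (step `n ↦ n+1` written as `k+1 ↦ k+2`).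
Data: `Z_{k+1} ≠ 0` (the step is defined); a majorant `Nin m′` of the input sizes `ε·‖𝒱_{k+1}‖_{klAnisoFamily k, univ}` in every even degree
`2m′` (the private invariant of the alignment memo); the sectorised slice `C′ = S(F̃_k)ᵀ·klSliceCov (k+2)·S(F̃_k)`, `F̃_k = bgmFatMultiplier … k`, in
Gram form on a bipartition `q` with constant `κ` and with row/column sums `≤ α`; an output index `j ≥ k+1` with the overlap constants `(cr, cc)` of
`E(klAnisoFamily j)·S(F̃_k)`; a radius `ρ > 0`; and `θ = eα·normV κ ρ Nin/κ² < 1`.  Conclusion: `Z_{k+2} ≠ 0`, and for every degree `m+1` and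
constraint set `A`, `‖𝒱_{k+2}‖_{klAnisoFamily j, A, m+1} ≤ cr·cc^m·ε^m·ρ^{-(m+1)}·e·normV κ ρ Nin/(1−θ)` (BGM 2006 (2.77) for the KL carriers; the
plateau of the input family is used only over the slice and the output family, `hubbardSectorKernelNorm_effAction_le_of_sectorNorm_of_plateau`). -/
theorem klNormsStep_of_sliceConsts {E : Type*} [NormedAddCommGroup E] [InnerProductSpace ℂ E]
    {β : ℝ} (hβ : 0 < β) (U μ : ℝ) (K : TrigPolyC4v) (k : ℕ)
    (hZ : klStepPartitionFn L M β U μ K (k + 1) ≠ 0)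
    (Nin : ℕ → ℝ)
    (hNin : ∀ m' : ℕ, imagTimeWeight β M *
      hubbardSectorKernelNorm L M β (klAnisoFamily L M β μ K klE0 k) (univ : Finset (Fin (2 * m') → SectorLeg (sectorCount k)))
        (klEffectiveAction L M β U μ K klE0 (k + 1)) ≤ Nin m')
    (q : SpaceTimeIdx L M × SectorLeg (sectorCount k) → Bool)
    (hC : ∀ X Y, q X = q Y →
      ((sectorSubMatrix L M β (bgmFatMultiplier L M klE0 β (nambuXiCT L μ K) k)).transpose * klSliceCov L M β μ K (k + 2) *
        sectorSubMatrix L M β (bgmFatMultiplier L M klE0 β (nambuXiCT L μ K) k)) X Y = 0)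
    (fv gv : SpaceTimeIdx L M × SectorLeg (sectorCount k) → E) {κ : ℝ} (hκ : 0 < κ) (hf : ∀ X, q X = true → ‖fv X‖ ≤ κ)
    (hg : ∀ Y, q Y = false → ‖gv Y‖ ≤ κ)
    (hGram : ∀ X Y, q X = true → q Y = false →
      contr ℂ ((sectorSubMatrix L M β (bgmFatMultiplier L M klE0 β (nambuXiCT L μ K) k)).transpose * klSliceCov L M β μ K (k + 2) *
        sectorSubMatrix L M β (bgmFatMultiplier L M klE0 β (nambuXiCT L μ K) k)) X Y = ⟪fv X, gv Y⟫_ℂ)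
    {α : ℝ} (hα : 0 < α)
    (hrow : ∀ X, ∑ Y, ‖((sectorSubMatrix L M β (bgmFatMultiplier L M klE0 β (nambuXiCT L μ K) k)).transpose *
      klSliceCov L M β μ K (k + 2) * sectorSubMatrix L M β (bgmFatMultiplier L M klE0 β (nambuXiCT L μ K) k)) X Y‖ ≤ α)
    (hcol : ∀ Y, ∑ X, ‖((sectorSubMatrix L M β (bgmFatMultiplier L M klE0 β (nambuXiCT L μ K) k)).transpose *
      klSliceCov L M β μ K (k + 2) * sectorSubMatrix L M β (bgmFatMultiplier L M klE0 β (nambuXiCT L μ K) k)) X Y‖ ≤ α)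
    {ρ : ℝ} (hρ : 0 < ρ)
    (hθ : Real.exp 1 * α * normV (SpaceTimeIdx L M × SectorLeg (sectorCount k)) κ ρ Nin / κ ^ 2 < 1)
    {j : ℕ} (hj : k + 1 ≤ j) {cr cc : ℝ} (hcr0 : 0 ≤ cr) (hcc0 : 0 ≤ cc)
    (hrow' : ∀ X'', ∑ X', ‖(sectorAnalysisMatrix L M β (klAnisoFamily L M β μ K klE0 j) *
      sectorSubMatrix L M β (bgmFatMultiplier L M klE0 β (nambuXiCT L μ K) k)) X'' X'‖ ≤ cr)
    (hcol' : ∀ X', ∑ X'', ‖(sectorAnalysisMatrix L M β (klAnisoFamily L M β μ K klE0 j) *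
      sectorSubMatrix L M β (bgmFatMultiplier L M klE0 β (nambuXiCT L μ K) k)) X'' X'‖ ≤ cc)
    (m : ℕ) (A : Finset (Fin (m + 1) → SectorLeg (sectorCount j))) :
    klStepPartitionFn L M β U μ K (k + 2) ≠ 0 ∧
      hubbardSectorKernelNorm L M β (klAnisoFamily L M β μ K klE0 j) A (klEffectiveAction L M β U μ K klE0 (k + 2)) ≤
        cr * cc ^ m * imagTimeWeight β M ^ m * (ρ⁻¹ ^ (m + 1) *
          (Real.exp 1 * normV (SpaceTimeIdx L M × SectorLeg (sectorCount k)) κ ρ Nin) /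
            (1 - Real.exp 1 * α * normV (SpaceTimeIdx L M × SectorLeg (sectorCount k)) κ ρ Nin / κ ^ 2)) := by
  have he : (0 : ℝ) < klE0 := by norm_num [klE0]
  -- notation
  set F : Fin (sectorCount k) → FreqMomentum L M → ℂ := klAnisoFamily L M β μ K klE0 k with hF
  set Ft : Fin (sectorCount k) → FreqMomentum L M → ℂ := bgmFatMultiplier L M klE0 β (nambuXiCT L μ K) k with hFt
  set F' : Fin (sectorCount j) → FreqMomentum L M → ℂ := klAnisoFamily L M β μ K klE0 j with hF'
  set G : HubbardGrassmann L M := klEffectiveAction L M β U μ K klE0 (k + 1) with hG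
  set C : Matrix (HubbardFieldIdx L M) (HubbardFieldIdx L M) ℂ := klSliceCov L M β μ K (k + 2) with hCdef
  -- the exact norms of the input and their majorant
  set Nex : ℕ → ℝ := fun m' => imagTimeWeight β M *
    hubbardSectorKernelNorm L M β F (univ : Finset (Fin (2 * m') → SectorLeg (sectorCount k))) G with hNex
  set nV : ℝ := normV (SpaceTimeIdx L M × SectorLeg (sectorCount k)) κ ρ Nex with hnV
  set nVin : ℝ := normV (SpaceTimeIdx L M × SectorLeg (sectorCount k)) κ ρ Nin with hnVin
  have hle : nV ≤ nVin := normV_mono hκ.le hρ.le fun m' => hNin m'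
  have hnV0 : 0 ≤ nV := normV_nonneg hκ.le hρ.le fun m' =>
    mul_nonneg (imagTimeWeight_nonneg hβ.le M) (hubbardSectorKernelNorm_nonneg hβ.le F univ G)
  have hθ' : Real.exp 1 * α * nV / κ ^ 2 < 1 := lt_of_le_of_lt (by gcongr) hθ
  -- the hypotheses of the plateau step
  have hFF : ∀ ω p, Ft ω p * F ω p = F ω p := fun ω p => bgmFatMultiplier_mul_bgmMultiplier he β (nambuXiCT L μ K) k ω p
  have hF0 : ∀ p, ∑ ω, F ω p = 0 → ∀ ω, F ω p = 0 := fun p hp ω => klAnisoFamily_eq_zero_of_sum_eq_zero β μ K klE0 k p hp ω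
  have hGe : G ∈ evenPart ℂ (HubbardFieldIdx L M) := mem_evenPart_iff.2 (klw_effectiveAction_mem_evenOdd_zero L M β U μ K (k + 1))
  have hG0 : constPart ℂ G = 0 := constPart_hubbardEffectiveActionCT L M β U μ 0 K hZ
  have hCpl : ∀ X Y, C X Y ≠ 0 → ∑ ω, F ω X.1.1 = 1 ∧ ∑ ω, F ω Y.1.1 = 1 :=
    fun X Y h => sum_klAnisoFamily_eq_one_of_klSliceCov_ne_zero β μ K k X Y h
  have hF'pl : ∀ (ω' : Fin (sectorCount j)) (p : FreqMomentum L M), F' ω' p ≠ 0 → ∑ ω, F ω p = 1 :=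
    fun ω' p h => sum_klAnisoFamily_eq_one_of_klAnisoFamily_ne_zero β μ K hj ω' p h
  -- the plateau step
  obtain ⟨hunit, hbd⟩ := hubbardSectorKernelNorm_effAction_le_of_sectorNorm_of_plateau hβ F Ft hFF hF0 F' G hGe hG0 C hCpl
    hF'pl q hC fv gv hκ hf hg hGram hα hrow hcol hρ hθ' hcr0 hcc0 hrow' hcol' m A
  -- the step identity `𝒱_{k+2} = effAction g_{k+2} 𝒱_{k+1}` and the partition functions
  have hstep : klEffectiveAction L M β U μ K klE0 (k + 2) = effAction ℂ C G := klw_effectiveAction_succ L M β U μ K (k + 1) hZ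
  refine ⟨?_, ?_⟩
  · -- `Z_{k+2} = Z_{k+1} · ∫dμ_{g_{k+2}} e^{-𝒱_{k+1}}`
    have hZ' : klStepPartitionFn L M β U μ K (k + 2) =
        klStepPartitionFn L M β U μ K (k + 1) * effPartitionFn ℂ C G := by
      have hcov : klHardCov L M β μ K (k + 2) = C + klHardCov L M β μ K (k + 1) := klw_hardCov_succ L M β μ K (k + 1)
      have hu : IsUnit (effPartitionFn ℂ (klHardCov L M β μ K (k + 1)) (hubbardInteractionCT L M β U K)) :=
        isUnit_iff_ne_zero.2 hZ
      show effPartitionFn ℂ (klHardCov L M β μ K (k + 2)) (hubbardInteractionCT L M β U K) =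
        effPartitionFn ℂ (klHardCov L M β μ K (k + 1)) (hubbardInteractionCT L M β U K) * effPartitionFn ℂ C G
      rw [hcov, effPartitionFn_add_of_isUnit _ _ _ hu]
      rfl
    rw [hZ']
    exact mul_ne_zero hZ hunit.ne_zero
  · rw [hstep]
    refine hbd.trans ?_
    have hB := step_bound_mono hκ hα hnV0 hle hθ
    have hε : 0 ≤ imagTimeWeight β M := imagTimeWeight_nonneg hβ.le M
    calc cr * cc ^ m * imagTimeWeight β M ^ m * (ρ⁻¹ ^ (m + 1) * (Real.exp 1 * nV) / (1 - Real.exp 1 * α * nV / κ ^ 2))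
        = cr * cc ^ m * imagTimeWeight β M ^ m * ρ⁻¹ ^ (m + 1) * (Real.exp 1 * nV / (1 - Real.exp 1 * α * nV / κ ^ 2)) := by
          ring
      _ ≤ cr * cc ^ m * imagTimeWeight β M ^ m * ρ⁻¹ ^ (m + 1) *
            (Real.exp 1 * nVin / (1 - Real.exp 1 * α * nVin / κ ^ 2)) :=
          mul_le_mul_of_nonneg_left hB (by positivity)
      _ = _ := by ring

/-! ## §3 The two readings: the private invariant at the next index, and the public (E1-v4) quantity -/

/-- **P(k+2) from P(k+1)** — the output measured in the thin family of index `k+1` (plateau `{t ≤ Λ_{k+2}}` ⊇ the support of the NEXT slice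
`klSliceCov (k+3)`), all label tuples admitted: the reading `j = k+1`, `A = univ` of `klNormsStep_of_sliceConsts` — the input size of the following
step in degree `m + 1`. -/
theorem klNormsStep_private {E : Type*} [NormedAddCommGroup E] [InnerProductSpace ℂ E]
    {β : ℝ} (hβ : 0 < β) (U μ : ℝ) (K : TrigPolyC4v) (k : ℕ)
    (hZ : klStepPartitionFn L M β U μ K (k + 1) ≠ 0)
    (Nin : ℕ → ℝ)
    (hNin : ∀ m' : ℕ, imagTimeWeight β M *
      hubbardSectorKernelNorm L M β (klAnisoFamily L M β μ K klE0 k) (univ : Finset (Fin (2 * m') → SectorLeg (sectorCount k)))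
        (klEffectiveAction L M β U μ K klE0 (k + 1)) ≤ Nin m')
    (q : SpaceTimeIdx L M × SectorLeg (sectorCount k) → Bool)
    (hC : ∀ X Y, q X = q Y →
      ((sectorSubMatrix L M β (bgmFatMultiplier L M klE0 β (nambuXiCT L μ K) k)).transpose * klSliceCov L M β μ K (k + 2) *
        sectorSubMatrix L M β (bgmFatMultiplier L M klE0 β (nambuXiCT L μ K) k)) X Y = 0)
    (fv gv : SpaceTimeIdx L M × SectorLeg (sectorCount k) → E) {κ : ℝ} (hκ : 0 < κ) (hf : ∀ X, q X = true → ‖fv X‖ ≤ κ)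
    (hg : ∀ Y, q Y = false → ‖gv Y‖ ≤ κ)
    (hGram : ∀ X Y, q X = true → q Y = false →
      contr ℂ ((sectorSubMatrix L M β (bgmFatMultiplier L M klE0 β (nambuXiCT L μ K) k)).transpose * klSliceCov L M β μ K (k + 2) *
        sectorSubMatrix L M β (bgmFatMultiplier L M klE0 β (nambuXiCT L μ K) k)) X Y = ⟪fv X, gv Y⟫_ℂ)
    {α : ℝ} (hα : 0 < α)
    (hrow : ∀ X, ∑ Y, ‖((sectorSubMatrix L M β (bgmFatMultiplier L M klE0 β (nambuXiCT L μ K) k)).transpose *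
      klSliceCov L M β μ K (k + 2) * sectorSubMatrix L M β (bgmFatMultiplier L M klE0 β (nambuXiCT L μ K) k)) X Y‖ ≤ α)
    (hcol : ∀ Y, ∑ X, ‖((sectorSubMatrix L M β (bgmFatMultiplier L M klE0 β (nambuXiCT L μ K) k)).transpose *
      klSliceCov L M β μ K (k + 2) * sectorSubMatrix L M β (bgmFatMultiplier L M klE0 β (nambuXiCT L μ K) k)) X Y‖ ≤ α)
    {ρ : ℝ} (hρ : 0 < ρ)
    (hθ : Real.exp 1 * α * normV (SpaceTimeIdx L M × SectorLeg (sectorCount k)) κ ρ Nin / κ ^ 2 < 1)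
    {cr cc : ℝ} (hcr0 : 0 ≤ cr) (hcc0 : 0 ≤ cc)
    (hrow' : ∀ X'', ∑ X', ‖(sectorAnalysisMatrix L M β (klAnisoFamily L M β μ K klE0 (k + 1)) *
      sectorSubMatrix L M β (bgmFatMultiplier L M klE0 β (nambuXiCT L μ K) k)) X'' X'‖ ≤ cr)
    (hcol' : ∀ X', ∑ X'', ‖(sectorAnalysisMatrix L M β (klAnisoFamily L M β μ K klE0 (k + 1)) *
      sectorSubMatrix L M β (bgmFatMultiplier L M klE0 β (nambuXiCT L μ K) k)) X'' X'‖ ≤ cc)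
    (m : ℕ) :
    hubbardSectorKernelNorm L M β (klAnisoFamily L M β μ K klE0 (k + 1))
        (univ : Finset (Fin (m + 1) → SectorLeg (sectorCount (k + 1)))) (klEffectiveAction L M β U μ K klE0 (k + 2)) ≤
      cr * cc ^ m * imagTimeWeight β M ^ m * (ρ⁻¹ ^ (m + 1) *
        (Real.exp 1 * normV (SpaceTimeIdx L M × SectorLeg (sectorCount k)) κ ρ Nin) /
          (1 - Real.exp 1 * α * normV (SpaceTimeIdx L M × SectorLeg (sectorCount k)) κ ρ Nin / κ ^ 2)) :=
  (klNormsStep_of_sliceConsts hβ U μ K k hZ Nin hNin q hC fv gv hκ hf hg hGram hα hrow hcol hρ hθ (le_refl (k + 1)) hcr0 hcc0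
    hrow' hcol' m univ).2

/-- **The public (E1-v4) left-hand side at the next scale** — `klAnisoLegKernelNorm … (k+2) (m+1)`, the anisotropic sectorised norm of
`𝒱_{k+2}` in its own thin family over BGM's constraint set: the reading `j = k+2`, `A = bgmSectorSet` of `klNormsStep_of_sliceConsts`. -/
theorem klAnisoLegKernelNorm_le_of_sliceConsts {E : Type*} [NormedAddCommGroup E] [InnerProductSpace ℂ E]
    {β : ℝ} (hβ : 0 < β) (U μ : ℝ) (K : TrigPolyC4v) (k : ℕ)
    (hZ : klStepPartitionFn L M β U μ K (k + 1) ≠ 0)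
    (Nin : ℕ → ℝ)
    (hNin : ∀ m' : ℕ, imagTimeWeight β M *
      hubbardSectorKernelNorm L M β (klAnisoFamily L M β μ K klE0 k) (univ : Finset (Fin (2 * m') → SectorLeg (sectorCount k)))
        (klEffectiveAction L M β U μ K klE0 (k + 1)) ≤ Nin m')
    (q : SpaceTimeIdx L M × SectorLeg (sectorCount k) → Bool)
    (hC : ∀ X Y, q X = q Y →
      ((sectorSubMatrix L M β (bgmFatMultiplier L M klE0 β (nambuXiCT L μ K) k)).transpose * klSliceCov L M β μ K (k + 2) *
        sectorSubMatrix L M β (bgmFatMultiplier L M klE0 β (nambuXiCT L μ K) k)) X Y = 0)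
    (fv gv : SpaceTimeIdx L M × SectorLeg (sectorCount k) → E) {κ : ℝ} (hκ : 0 < κ) (hf : ∀ X, q X = true → ‖fv X‖ ≤ κ)
    (hg : ∀ Y, q Y = false → ‖gv Y‖ ≤ κ)
    (hGram : ∀ X Y, q X = true → q Y = false →
      contr ℂ ((sectorSubMatrix L M β (bgmFatMultiplier L M klE0 β (nambuXiCT L μ K) k)).transpose * klSliceCov L M β μ K (k + 2) *
        sectorSubMatrix L M β (bgmFatMultiplier L M klE0 β (nambuXiCT L μ K) k)) X Y = ⟪fv X, gv Y⟫_ℂ)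
    {α : ℝ} (hα : 0 < α)
    (hrow : ∀ X, ∑ Y, ‖((sectorSubMatrix L M β (bgmFatMultiplier L M klE0 β (nambuXiCT L μ K) k)).transpose *
      klSliceCov L M β μ K (k + 2) * sectorSubMatrix L M β (bgmFatMultiplier L M klE0 β (nambuXiCT L μ K) k)) X Y‖ ≤ α)
    (hcol : ∀ Y, ∑ X, ‖((sectorSubMatrix L M β (bgmFatMultiplier L M klE0 β (nambuXiCT L μ K) k)).transpose *
      klSliceCov L M β μ K (k + 2) * sectorSubMatrix L M β (bgmFatMultiplier L M klE0 β (nambuXiCT L μ K) k)) X Y‖ ≤ α)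
    {ρ : ℝ} (hρ : 0 < ρ)
    (hθ : Real.exp 1 * α * normV (SpaceTimeIdx L M × SectorLeg (sectorCount k)) κ ρ Nin / κ ^ 2 < 1)
    {cr cc : ℝ} (hcr0 : 0 ≤ cr) (hcc0 : 0 ≤ cc)
    (hrow' : ∀ X'', ∑ X', ‖(sectorAnalysisMatrix L M β (klAnisoFamily L M β μ K klE0 (k + 2)) *
      sectorSubMatrix L M β (bgmFatMultiplier L M klE0 β (nambuXiCT L μ K) k)) X'' X'‖ ≤ cr)
    (hcol' : ∀ X', ∑ X'', ‖(sectorAnalysisMatrix L M β (klAnisoFamily L M β μ K klE0 (k + 2)) *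
      sectorSubMatrix L M β (bgmFatMultiplier L M klE0 β (nambuXiCT L μ K) k)) X'' X'‖ ≤ cc)
    (m : ℕ) :
    klAnisoLegKernelNorm L M β U μ K klE0 (k + 2) (m + 1) ≤
      cr * cc ^ m * imagTimeWeight β M ^ m * (ρ⁻¹ ^ (m + 1) *
        (Real.exp 1 * normV (SpaceTimeIdx L M × SectorLeg (sectorCount k)) κ ρ Nin) /
          (1 - Real.exp 1 * α * normV (SpaceTimeIdx L M × SectorLeg (sectorCount k)) κ ρ Nin / κ ^ 2)) :=
  (klNormsStep_of_sliceConsts hβ U μ K k hZ Nin hNin q hC fv gv hκ hf hg hGram hα hrow hcol hρ hθ (by omega) hcr0 hcc0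
    hrow' hcol' m _).2

end Door

end Summit.HubbardSuperconductivity.HubbardSuperconductivity.Theorems.EngineV8

end
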